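import Summits.BirchSwinnertonDyer.BirchSwinnertonDyer.Theorems.AlignedTransportAtTwoMainConjectureOfRankZeroBSDAtTwoResolventLambdaParity
import Literature.NumberTheory.IwasawaTheory.ImaginaryQuadraticTwoTowerGenusRankAnyCyclotomic
import HarnessLib

/-!
# Route `AlignedTransportAtTwo`, crux C2 `MainConjectureOfRankZeroBSDAtTwo` (stmt-BirchSwinnertonDyer-22298):
# GENUS THEORY INSIDE THE RESOLVENT TOWER — `rank₂ Cl(ℚ(√Δ_W)_n) = t_n − 1` exactly, and the UNCONDITIONAL ODD-RANK LAW: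
# on the Kilford sub-cell `rank₂ Cl(ℚ(W[2])_n)` is ODD at EVERY layer `n ≥ 1` of the cyclotomic `ℤ₂`-tower

HONEST FRAMING (cell `bsd-f1-sign2`, WIDTH-5 attached prover seat `bsd-line-att-p3` gen 30, line `birth`, lead `bsd-line-att-p2`; `--supports`
stmt-BirchSwinnertonDyer-22298, closes nothing; BSD is NOT proved by any of this; the crux C2, its verdict «blocked-on `Rank1Residual.GreenbergMuConjectureIrreducible`»
and every registered stub (P / T / Kμ / LimDoor / MuIneqʳ / PFμ⁺) are untouched).  THEOREMS ONLY — no definition, no named fact, no `sorry`; NOTHING here is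
conditional on a named fact (gen 29's parity bit needed `μ₂ = 0` and the Ferrero–Kida fact; the rank parity below needs neither).

THE INPUT (this seat's Literature files, gen 30): `IwasawaTheory/ImaginaryQuadraticTwoTowerGenusRank` — for an imaginary quadratic `K` with ODD `d_K` and every
cyclotomic `ℤ₂`-extension, **`rank₂ Cl(K_n) = t_n − 1`, `t_n = Σ_{ℓ ∣ d_K} g_n(ℓ)`**, `g_n(ℓ) = #{primes of ℚ_n above ℓ}` (Okazaki's Lemma 17 on the CM field
`K·ℚ_n`, whose ramified primes are EXACTLY those above `ℓ ∣ d_K`, since `ℚ_n` is unramified at odd `ℓ`); `IwasawaTheory/CyclotomicTwoTowerOddPrimeDecomposition` —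
for `n ≥ 1`, **`g_n(ℓ) = 1 ⟺ ℓ ≡ ±3 (mod 8)`**, otherwise `g_n(ℓ)` is even (`Gal(ℚ_n/ℚ)` cyclic: inert in `ℚ_1 = ℚ(√2)` ⟺ inert in every `ℚ_n`;
`NumberFields/CyclicPrimePowerUniquePrimeOver`); hence the χ₈ PARITY LAW `rank₂ Cl(K_n) + 1 ≡ #{ℓ ∣ d_K : ℓ ≡ ±3 (8)} (mod 2)`, i.e. for `K = ℚ(√−d)`,
`d ≡ 3 (mod 4)` squarefree: `rank₂ Cl(K_n)` is ODD iff `d ≡ 7 (mod 8)`, EVEN iff `d ≡ 3 (mod 8)` (`n ≥ 1`).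

THIS FILE (`W/ℚ` elliptic, `Δ_W = −d·q²` with `d ≡ 3 (mod 4)` squarefree, `q ∈ ℚˣ`; `δ² = Δ_W`; `κ`, `κT` ANY cyclotomic `ℤ₂`-extensions of `ℚ(δ) = ℚ(√−d)`,
`ℚ(W[2])`):
* §1 `odd_classGroupPRank_resolvent_iff` — the resolvent tower: `rank₂ Cl(ℚ(√Δ_W)_n)` odd iff `d ≡ 7 (8)`, even iff `d ≡ 3 (8)` (`n ≥ 1`);
  `classGroupPRank_resolvent_eq` — `rank₂ Cl(ℚ(√Δ_W)_n) = Σ_{ℓ ∣ d} g_n(ℓ) − 1` (every `n`), `rank₂ Cl(ℚ(√Δ_W)) = ω(d) − 1`.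
* §2 ★ **`odd_classGroupPRank_divisionField_two_iff`** — via gen 29's transfer `rank₂ Cl(ℚ(W[2])_n) ≡ rank₂ Cl(ℚ(√Δ_W)_n) (mod 2)`:
  **`rank₂ Cl(ℚ(W[2])_n)` is ODD iff `d ≡ 7 (mod 8)` and EVEN iff `d ≡ 3 (mod 8)`, for every `n ≥ 1`** — unconditional;
  ★ `classGroupPRank_divisionField_two_ge` — **`rank₂ Cl(ℚ(W[2])_n) ≥ Σ_{ℓ ∣ d} g_n(ℓ) − 1`** (every `n`), unconditional.
* §3 ★ **`odd_classGroupPRank_divisionField_two_of_onKilfordStratumAtTwo`** — ON the Kilford stratum (`d ≡ 7 (mod 8)` is forced, gen 29):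
  **`rank₂ Cl(ℚ(W[2])_n)` is ODD for every `n ≥ 1`**; ★ `rankCert_odd_and_three_le` — a 2-RANK CERTIFICATE `r_{n+1} = r_n` at `n ≥ 1` on the sextic has ODD value
  `r ≥ 3` (g28: `3 ≤ λ₂ ≤ r`), so `r ∉ {4, 6, …}`: `rankCert_ne_four`; `rankCert_zero_odd` — a certificate at the pair `(0, 1)` has odd value too.

WHAT THIS BUYS THE CRUX (numbers, not adjectives).  Gen 27/28: the C2 input on the Kilford sub-cell is a 2-rank certificate on `ℚ(W[2])` of value `r ≥ 3`;
gen 29: `λ₂(ℚ(W[2]))` odd GRANTED `μ₂ = 0` and Ferrero–Kida.  Now, with no hypothesis at all: the certificate's value is ODD (`3, 5, 7, …`), at every layer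
`n ≥ 1`; and every `-data` row `rank₂ Cl(ℚ(W[2])_n) = r` with `n ≥ 1` must be odd on the stratum (even on the `d ≡ 3 (8)` class) — a zero-cost check of the
class-group tables layer by layer, not only at `n = 0`.  Nothing is closed; the law constrains, it does not produce, the certificate.

References: [Ferrero1980AJM] §2; [Kida1979Tohoku] Thm. 1; [Okazaki2000] §3 Lemma 17; [Washington1997] Thm. 10.8, §13.1, §13.3; [Fukuda1994] Thm. 1 (2);
this seat's p763250 / p763370 / p763581 and gen 29's `…ResolventParity`, `…ResolventLambdaParity`.
-/

set_option linter.dupNamespace false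
set_option autoImplicit false

noncomputable section

open scoped Classical NumberField

namespace Summit.BirchSwinnertonDyer.BirchSwinnertonDyer.Theorems.AlignedTransportAtTwoResolventTowerGenus

open Polynomial WeierstrassCurve IntermediateField Field NumberField Finset
  Literature.NumberTheory.EllipticCurves Literature.NumberTheory.EllipticCurves.Greenberg1999 Literature.NumberTheory.GaloisRepresentations
  Literature.NumberTheory.EllipticCurves.ZpExtension Literature.NumberTheory.IwasawaTheory Literature.NumberTheory.NumberFields
  Summit.BirchSwinnertonDyer.Rank1Residual.F1Sign2
  Summit.BirchSwinnertonDyer.BirchSwinnertonDyer.Theorems.AlignedTransportAtTwoKilfordStratumShared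
  Summit.BirchSwinnertonDyer.BirchSwinnertonDyer.Theorems.AlignedTransportAtTwoKilfordStratum
  Summit.BirchSwinnertonDyer.BirchSwinnertonDyer.Theorems.AlignedTransportAtTwoResolventParity
  Summit.BirchSwinnertonDyer.BirchSwinnertonDyer.Theorems.AlignedTransportAtTwoResolventLambdaParity
  Summit.BirchSwinnertonDyer.BirchSwinnertonDyer.Theorems.AlignedTransportAtTwoRankCertificateLambda

variable (W : WeierstrassCurve ℚ) [W.IsElliptic]

/-! ## §1 The resolvent tower `ℚ(√Δ_W)^{cyc}`: exact `2`-rank and its parity -/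

omit [W.IsElliptic] in
/-- `d ≡ 3 (mod 4)` squarefree ⟹ `2 < d` (`d ≠ 1` is not `3 (mod 4)`... rather: `d ≥ 3`). [folklore] -/
private theorem two_lt_of_mod_four_eq_three {d : ℕ} (hd4 : d % 4 = 3) : 2 < d := by omega

omit [W.IsElliptic] in
/-- ★ **The resolvent tower's parity law.**  `Δ_W = −d·q²` (`d ≡ 3 (mod 4)` squarefree, `q ∈ ℚˣ`), `δ² = Δ_W`, `κ` ANY cyclotomic `ℤ₂`-extension of
`ℚ(δ) = ℚ(√−d)`, `n ≥ 1`: **`rank₂ Cl(ℚ(√Δ_W)_n)` is ODD iff `d ≡ 7 (mod 8)`, EVEN iff `d ≡ 3 (mod 8)`** (genus theory in the tower + χ₈).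
[cite: Ferrero1980AJM, §2] [cite: Washington1997, Thm. 10.8 and §13.1] -/
theorem odd_classGroupPRank_resolvent_iff {d : ℕ} (hd : Squarefree d) (hd4 : d % 4 = 3) {q : ℚ} (hq : q ≠ 0) (hΔ : W.Δ = -(d : ℚ) * q ^ 2)
    {δ : AlgebraicClosure ℚ} (hδ : δ ^ 2 = ((W.Δ : ℚ) : AlgebraicClosure ℚ)) (κ : ZpExtension ℚ⟮δ⟯ 2) (hκ : κ.IsCyclotomic)
    {n : ℕ} (hn : 1 ≤ n) :
    (Odd (classGroupPRank κ n) ↔ d % 8 = 7) ∧ (Even (classGroupPRank κ n) ↔ d % 8 = 3) := by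
  have hδint : IsIntegral ℚ δ := ((AlgebraicClosure.isAlgebraic ℚ).isAlgebraic δ).isIntegral
  haveI : FiniteDimensional ℚ ℚ⟮δ⟯ := IntermediateField.adjoin.finiteDimensional hδint
  haveI : NumberField ℚ⟮δ⟯ := NumberField.mk
  obtain ⟨hK2, hη⟩ := exists_sq_eq_neg_of_sq_eq W (two_lt_of_mod_four_eq_three hd4) hq hΔ hδ
  exact odd_classGroupPRank_cyclotomic_two_iff_of_sq_eq_neg ℚ⟮δ⟯ hK2 hd hd4 hη κ hκ hn

omit [W.IsElliptic] in
/-- **The resolvent tower's exact `2`-rank**: `rank₂ Cl(ℚ(√Δ_W)_n) = Σ_{ℓ ∣ d} g_n(ℓ) − 1` with `Σ ≥ 1` (every `n`; `g_n(ℓ)` = number of primes above `ℓ`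
in the `n`-th layer of `ℚ`'s cyclotomic `ℤ₂`-extension), and `rank₂ Cl(ℚ(√Δ_W)) = ω(d) − 1` (Gauss).  `Δ_W = −d·q²`, `d ≡ 3 (mod 4)` squarefree.
[cite: Ferrero1980AJM, §2] [cite: Okazaki2000, §3 Lemma 17] -/
theorem classGroupPRank_resolvent_eq {d : ℕ} (hd : Squarefree d) (hd4 : d % 4 = 3) {q : ℚ} (hq : q ≠ 0) (hΔ : W.Δ = -(d : ℚ) * q ^ 2)
    {δ : AlgebraicClosure ℚ} (hδ : δ ^ 2 = ((W.Δ : ℚ) : AlgebraicClosure ℚ)) (κ : ZpExtension ℚ⟮δ⟯ 2) (hκ : κ.IsCyclotomic) (n : ℕ) :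
    (classGroupPRank κ n =
        (∑ ℓ ∈ d.primeFactors, ((Ideal.span {(ℓ : ℤ)}).primesOver (𝓞 ↥((CyclotomicZp.zpExtension 2).layer n))).ncard) - 1 ∧
      1 ≤ ∑ ℓ ∈ d.primeFactors, ((Ideal.span {(ℓ : ℤ)}).primesOver (𝓞 ↥((CyclotomicZp.zpExtension 2).layer n))).ncard) ∧
      classGroupPRank κ 0 = d.primeFactors.card - 1 := by
  have hδint : IsIntegral ℚ δ := ((AlgebraicClosure.isAlgebraic ℚ).isAlgebraic δ).isIntegral
  haveI : FiniteDimensional ℚ ℚ⟮δ⟯ := IntermediateField.adjoin.finiteDimensional hδint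
  haveI : NumberField ℚ⟮δ⟯ := NumberField.mk
  obtain ⟨hK2, hη⟩ := exists_sq_eq_neg_of_sq_eq W (two_lt_of_mod_four_eq_three hd4) hq hΔ hδ
  exact classGroupPRank_cyclotomic_two_eq_of_sq_eq_neg ℚ⟮δ⟯ hK2 hd hd4 hη κ hκ n

/-! ## §2 The sextic carrier `ℚ(W[2])^{cyc}`: the UNCONDITIONAL parity of `rank₂ Cl(ℚ(W[2])_n)`, `n ≥ 1` -/

/-- ★ **`rank₂ Cl(ℚ(W[2])_n)` is ODD iff `d ≡ 7 (mod 8)` and EVEN iff `d ≡ 3 (mod 8)`, at every layer `n ≥ 1`** — `W/ℚ` elliptic with `Δ_W = −d·q²`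
(`d ≡ 3 (mod 4)` squarefree, `q ∈ ℚˣ`), `κT` ANY cyclotomic `ℤ₂`-extension of `ℚ(W[2])`; UNCONDITIONAL (no `μ = 0`, no named fact): gen 29's transfer
`rank₂ Cl(ℚ(W[2])_n) ≡ rank₂ Cl(ℚ(√Δ_W)_n) (mod 2)` (coprime Galois descent through the `C₃`-step) composed with §1 on the restriction of `ℚ`'s cyclotomic
`ℤ₂`-extension to `ℚ(√Δ_W)`. [cite: Ferrero1980AJM, §2] [cite: Washington1997, Thm. 10.8 and §13.1] -/
theorem odd_classGroupPRank_divisionField_two_iff {d : ℕ} (hd : Squarefree d) (hd4 : d % 4 = 3) {q : ℚ} (hq : q ≠ 0)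
    (hΔ : W.Δ = -(d : ℚ) * q ^ 2) (κT : ZpExtension (W.divisionField 2) 2) (hκT : κT.IsCyclotomic) {n : ℕ} (hn : 1 ≤ n) :
    (Odd (classGroupPRank κT n) ↔ d % 8 = 7) ∧ (Even (classGroupPRank κT n) ↔ d % 8 = 3) := by
  have h2d := two_lt_of_mod_four_eq_three hd4
  have hsq : ¬ IsSquare W.Δ := not_isSquare_Δ_of_eq_neg_mul_sq W h2d hq hΔ
  -- a square root `δ` of `Δ_W` in `ℚ̄` and the restriction of `ℚ`'s cyclotomic `ℤ₂`-extension to `ℚ(δ)`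
  obtain ⟨δ, hδ⟩ : ∃ δ : AlgebraicClosure ℚ, δ ^ 2 = ((W.Δ : ℚ) : AlgebraicClosure ℚ) := by
    obtain ⟨δ, hδ⟩ := IsAlgClosed.exists_pow_nat_eq ((W.Δ : ℚ) : AlgebraicClosure ℚ) two_pos
    exact ⟨δ, hδ⟩
  have hδint : IsIntegral ℚ δ := ((AlgebraicClosure.isAlgebraic ℚ).isAlgebraic δ).isIntegral
  haveI : FiniteDimensional ℚ ℚ⟮δ⟯ := IntermediateField.adjoin.finiteDimensional hδint
  haveI : NumberField ℚ⟮δ⟯ := NumberField.mk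
  obtain ⟨hK2, hη⟩ := exists_sq_eq_neg_of_sq_eq W h2d hq hΔ hδ
  obtain ⟨hIQ, -, -⟩ := isImaginaryQuadratic_and_natAbs_discr_eq_of_sq_eq_neg ℚ⟮δ⟯ hK2 hd hd4 hη
  have hcyc := CyclotomicZp.isCyclotomic_zpExtension 2
  have hsurj := surjective_comp_absGaloisRestrict_imaginaryQuadratic_two hcyc ℚ⟮δ⟯ hIQ
  set κ := (CyclotomicZp.zpExtension 2).restrict ℚ⟮δ⟯ hsurj with hκdef
  have hκ : κ.IsCyclotomic := isCyclotomic_restrict (CyclotomicZp.zpExtension 2) hcyc ℚ⟮δ⟯ hsurj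
  obtain ⟨hmod, -⟩ := classGroupPRank_divisionField_two_modEq_two_resolvent W hsq hδ κ hκ κT hκT n
  obtain ⟨hodd, heven⟩ := odd_classGroupPRank_resolvent_iff W hd hd4 hq hΔ hδ κ hκ hn
  have hm : classGroupPRank κT n % 2 = classGroupPRank κ n % 2 := hmod
  refine ⟨?_, ?_⟩
  · rw [Nat.odd_iff] at hodd ⊢
    rw [hm]
    exact hodd
  · rw [Nat.even_iff] at heven ⊢
    rw [hm]
    exact heven

/-- ★ **`rank₂ Cl(ℚ(W[2])_n) ≥ Σ_{ℓ ∣ d} g_n(ℓ) − 1` at every layer `n`** (`Δ_W = −d·q²`, `d ≡ 3 (mod 4)` squarefree; `κT` any cyclotomic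
`ℤ₂`-extension of `ℚ(W[2])`; `g_n(ℓ)` = number of primes above `ℓ` in the `n`-th layer of `ℚ`'s cyclotomic `ℤ₂`-extension) — UNCONDITIONAL: gen 29's
`rank₂ Cl(ℚ(√Δ_W)_n) ≤ rank₂ Cl(ℚ(W[2])_n)` and §1's exact count on the resolvent. [cite: Ferrero1980AJM, §2] [cite: Okazaki2000, §3 Lemma 17]
[cite: Washington1997, Thm. 10.8] -/
theorem classGroupPRank_divisionField_two_ge {d : ℕ} (hd : Squarefree d) (hd4 : d % 4 = 3) {q : ℚ} (hq : q ≠ 0)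
    (hΔ : W.Δ = -(d : ℚ) * q ^ 2) (κT : ZpExtension (W.divisionField 2) 2) (hκT : κT.IsCyclotomic) (n : ℕ) :
    (∑ ℓ ∈ d.primeFactors, ((Ideal.span {(ℓ : ℤ)}).primesOver (𝓞 ↥((CyclotomicZp.zpExtension 2).layer n))).ncard) - 1 ≤
        classGroupPRank κT n ∧
      d.primeFactors.card - 1 ≤ classGroupPRank κT 0 := by
  have h2d := two_lt_of_mod_four_eq_three hd4
  have hsq : ¬ IsSquare W.Δ := not_isSquare_Δ_of_eq_neg_mul_sq W h2d hq hΔ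
  obtain ⟨δ, hδ⟩ : ∃ δ : AlgebraicClosure ℚ, δ ^ 2 = ((W.Δ : ℚ) : AlgebraicClosure ℚ) := by
    obtain ⟨δ, hδ⟩ := IsAlgClosed.exists_pow_nat_eq ((W.Δ : ℚ) : AlgebraicClosure ℚ) two_pos
    exact ⟨δ, hδ⟩
  have hδint : IsIntegral ℚ δ := ((AlgebraicClosure.isAlgebraic ℚ).isAlgebraic δ).isIntegral
  haveI : FiniteDimensional ℚ ℚ⟮δ⟯ := IntermediateField.adjoin.finiteDimensional hδint
  haveI : NumberField ℚ⟮δ⟯ := NumberField.mk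
  obtain ⟨hK2, hη⟩ := exists_sq_eq_neg_of_sq_eq W h2d hq hΔ hδ
  obtain ⟨hIQ, -, -⟩ := isImaginaryQuadratic_and_natAbs_discr_eq_of_sq_eq_neg ℚ⟮δ⟯ hK2 hd hd4 hη
  have hcyc := CyclotomicZp.isCyclotomic_zpExtension 2
  have hsurj := surjective_comp_absGaloisRestrict_imaginaryQuadratic_two hcyc ℚ⟮δ⟯ hIQ
  set κ := (CyclotomicZp.zpExtension 2).restrict ℚ⟮δ⟯ hsurj with hκdef
  have hκ : κ.IsCyclotomic := isCyclotomic_restrict (CyclotomicZp.zpExtension 2) hcyc ℚ⟮δ⟯ hsurj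
  obtain ⟨⟨hn, -⟩, h0⟩ := classGroupPRank_resolvent_eq W hd hd4 hq hΔ hδ κ hκ n
  obtain ⟨⟨-, -⟩, h00⟩ := classGroupPRank_resolvent_eq W hd hd4 hq hΔ hδ κ hκ 0
  obtain ⟨-, hle⟩ := classGroupPRank_divisionField_two_modEq_two_resolvent W hsq hδ κ hκ κT hκT n
  obtain ⟨-, hle0⟩ := classGroupPRank_divisionField_two_modEq_two_resolvent W hsq hδ κ hκ κT hκT 0
  exact ⟨hn ▸ hle, h00 ▸ hle0⟩

/-! ## §3 The Kilford sub-cell: `rank₂ Cl(ℚ(W[2])_n)` is ODD for every `n ≥ 1`; rank certificates have odd value `≥ 3` -/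

/-- ★ **THE ODD-RANK LAW ON THE KILFORD STRATUM.**  `W/ℚ` elliptic ON the Kilford stratum with `Δ_W = −d·q²` (`d` odd squarefree, `q ∈ ℚˣ`; then `d ≡ 7 (mod 8)`,
gen 29, unconditional), `κT` ANY cyclotomic `ℤ₂`-extension of `ℚ(W[2])`: **`rank₂ Cl(ℚ(W[2])_n)` is ODD for every `n ≥ 1`** — no `μ = 0`, no named fact.
[cite: Ferrero1980AJM, §2] [cite: Serre1973, Ch. II §3.3 Thm. 4] [cite: Washington1997, Thm. 10.8 and §13.1] -/
theorem odd_classGroupPRank_divisionField_two_of_onKilfordStratumAtTwo (hs : OnKilfordStratumAtTwo W) {d : ℕ} (hd : Squarefree d) (hodd : Odd d)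
    {q : ℚ} (hq : q ≠ 0) (hΔ : W.Δ = -(d : ℚ) * q ^ 2) (κT : ZpExtension (W.divisionField 2) 2) (hκT : κT.IsCyclotomic) {n : ℕ} (hn : 1 ≤ n) :
    Odd (classGroupPRank κT n) := by
  have h7 := mod_eight_eq_seven_of_onKilfordStratumAtTwo W hs hodd hq hΔ
  exact (odd_classGroupPRank_divisionField_two_iff W hd (by omega) hq hΔ κT hκT hn).1.mpr h7

/-- **`rank₂ Cl(ℚ(W[2])_n) ≠ 0, 2, 4, …` on the Kilford stratum (`n ≥ 1`)**: the even values are excluded at every layer. [cite: Ferrero1980AJM, §2]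
[cite: Washington1997, Thm. 10.8] -/
theorem classGroupPRank_divisionField_two_ne_two_mul_of_onKilfordStratumAtTwo (hs : OnKilfordStratumAtTwo W) {d : ℕ} (hd : Squarefree d) (hodd : Odd d)
    {q : ℚ} (hq : q ≠ 0) (hΔ : W.Δ = -(d : ℚ) * q ^ 2) (κT : ZpExtension (W.divisionField 2) 2) (hκT : κT.IsCyclotomic) {n : ℕ} (hn : 1 ≤ n)
    (m : ℕ) : classGroupPRank κT n ≠ 2 * m := by
  intro h
  have hodd' := odd_classGroupPRank_divisionField_two_of_onKilfordStratumAtTwo W hs hd hodd hq hΔ κT hκT hn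
  rw [h] at hodd'
  exact (Nat.not_even_iff_odd.mpr hodd') (even_two_mul m)

/-- ★ **A 2-RANK CERTIFICATE ON THE KILFORD STRATUM HAS ODD VALUE `≥ 3`.**  `W` with no rational `2`-torsion abscissa, `Δ_W = −d·q² < 0` (`d` odd squarefree,
`q ∈ ℚˣ`), ON the stratum; `κT` any cyclotomic `ℤ₂`-extension of `ℚ(W[2])`; a certificate `rank₂ Cl(T_{n+1}) = rank₂ Cl(T_n)` at a layer `n ≥ 1`.  Then
`μ₂ = 0`, **`3 ≤ λ₂(ℚ(W[2])) ≤ r`, and the value `r = rank₂ Cl(T_n)` is ODD** (gen 28's sandwich + the odd-rank law).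
[cite: Fukuda1994, Thm. 1 (2), p. 264] [cite: Ferrero1980AJM, §2] [cite: Washington1997, Thm. 10.8 and §13.3 Thm. 13.13] -/
theorem rankCert_odd_and_three_le (ht : ∀ x : ℚ, ¬ HasRationalTwoTorsionX W x) (hs : OnKilfordStratumAtTwo W) {d : ℕ} (hd : Squarefree d)
    (hodd : Odd d) {q : ℚ} (hq : q ≠ 0) (hΔ : W.Δ = -(d : ℚ) * q ^ 2) (κT : ZpExtension (W.divisionField 2) 2) (hκT : κT.IsCyclotomic)
    {n : ℕ} (hn : 1 ≤ n) (hcert : classGroupPRank κT (n + 1) = classGroupPRank κT n) :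
    Odd (classGroupPRank κT n) ∧ ClassicalMuVanishes κT ∧ 3 ≤ classicalLambda κT ∧ classicalLambda κT ≤ classGroupPRank κT n := by
  have hΔneg : W.Δ < 0 := by
    rw [hΔ]
    have hd0 : (0 : ℚ) < d := by exact_mod_cast (show 0 < d by obtain ⟨k, rfl⟩ := hodd; omega)
    have hq2 : 0 < q ^ 2 := by positivity
    nlinarith
  exact ⟨odd_classGroupPRank_divisionField_two_of_onKilfordStratumAtTwo W hs hd hodd hq hΔ κT hκT hn,
    three_le_classicalLambda_and_le_of_rankCert_divisionField_two W ht hΔneg hs κT hκT hcert⟩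

/-- **No certificate of value `4` (or any even value) on the Kilford stratum at a layer `n ≥ 1`** — gen 29 excluded `λ₂ = 4` granted `μ = 0` and
Ferrero–Kida; the CERTIFICATE value `4` is now excluded unconditionally. [cite: Fukuda1994, Thm. 1 (2), p. 264] [cite: Washington1997, Thm. 10.8] -/
theorem rankCert_ne_four (hs : OnKilfordStratumAtTwo W) {d : ℕ} (hd : Squarefree d) (hodd : Odd d) {q : ℚ} (hq : q ≠ 0)
    (hΔ : W.Δ = -(d : ℚ) * q ^ 2) (κT : ZpExtension (W.divisionField 2) 2) (hκT : κT.IsCyclotomic) {n : ℕ} (hn : 1 ≤ n)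
    (hcert : classGroupPRank κT (n + 1) = classGroupPRank κT n) : classGroupPRank κT n ≠ 4 ∧ classGroupPRank κT (n + 1) ≠ 4 := by
  have h := classGroupPRank_divisionField_two_ne_two_mul_of_onKilfordStratumAtTwo W hs hd hodd hq hΔ κT hκT hn 2
  refine ⟨h, ?_⟩
  rw [hcert]
  exact h

/-- **A certificate at the pair `(0, 1)` on the Kilford stratum also has ODD value** (`rank₂ Cl(T_1) = rank₂ Cl(T_0)` and `rank₂ Cl(T_1)` is odd), so
`rank₂ Cl(ℚ(W[2])) = r₀` even (e.g. the five `ω(d) = 1` seeds of gen 29's census, `r₀ ≡ ω(d) − 1 = 0`) admits NO certificate at `(0, 1)`.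
[cite: Fukuda1994, Thm. 1 (2), p. 264] [cite: Ferrero1980AJM, §2] -/
theorem rankCert_zero_odd (hs : OnKilfordStratumAtTwo W) {d : ℕ} (hd : Squarefree d) (hodd : Odd d) {q : ℚ} (hq : q ≠ 0)
    (hΔ : W.Δ = -(d : ℚ) * q ^ 2) (κT : ZpExtension (W.divisionField 2) 2) (hκT : κT.IsCyclotomic)
    (hcert : classGroupPRank κT (0 + 1) = classGroupPRank κT 0) : Odd (classGroupPRank κT 0) := by
  rw [← hcert]
  exact odd_classGroupPRank_divisionField_two_of_onKilfordStratumAtTwo W hs hd hodd hq hΔ κT hκT le_rfl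

/-- **No certificate at the pair `(0, 1)` when `rank₂ Cl(ℚ(W[2]))` is even** (Kilford stratum) — in particular for the seeds with `ω(d)` odd, where gen 29's
layer-`0` law gives `rank₂ Cl(ℚ(W[2])) ≡ ω(d) − 1 ≡ 0 (mod 2)`: the first possible certificate sits at a pair `(n, n+1)` with `n ≥ 1`.
[cite: Fukuda1994, Thm. 1 (2), p. 264] [cite: Ferrero1980AJM, §2] -/
theorem no_rankCert_zero_of_even (hs : OnKilfordStratumAtTwo W) {d : ℕ} (hd : Squarefree d) (hodd : Odd d) {q : ℚ} (hq : q ≠ 0)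
    (hΔ : W.Δ = -(d : ℚ) * q ^ 2) (κT : ZpExtension (W.divisionField 2) 2) (hκT : κT.IsCyclotomic) (heven : Even (classGroupPRank κT 0)) :
    classGroupPRank κT 1 ≠ classGroupPRank κT 0 := by
  intro hcert
  exact (Nat.not_even_iff_odd.mpr (rankCert_zero_odd W hs hd hodd hq hΔ κT hκT hcert)) heven

/-- The `Δ_min ≡ 1 (mod 8)` form of the odd-rank law (`W` globally minimal, good ordinary at `2`; tree `onKilfordStratumAtTwo_iff_minimalDiscriminantInt_emod_eight`):
`rank₂ Cl(ℚ(W[2])_n)` is odd for every `n ≥ 1`. [cite: Serre1973, Ch. II §3.3 Thm. 4] [cite: Ferrero1980AJM, §2] -/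
theorem odd_classGroupPRank_divisionField_two_of_minimalDiscriminantInt_emod_eight [W.IsGloballyMinimal] (hord : IsOrdinaryAt W 2)
    (h8 : minimalDiscriminantInt W % 8 = 1) {d : ℕ} (hd : Squarefree d) (hodd : Odd d) {q : ℚ} (hq : q ≠ 0) (hΔ : W.Δ = -(d : ℚ) * q ^ 2)
    (κT : ZpExtension (W.divisionField 2) 2) (hκT : κT.IsCyclotomic) {n : ℕ} (hn : 1 ≤ n) : Odd (classGroupPRank κT n) :=
  odd_classGroupPRank_divisionField_two_of_onKilfordStratumAtTwo W ((onKilfordStratumAtTwo_iff_minimalDiscriminantInt_emod_eight W hord).mpr h8)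
    hd hodd hq hΔ κT hκT hn

end Summit.BirchSwinnertonDyer.BirchSwinnertonDyer.Theorems.AlignedTransportAtTwoResolventTowerGenus

end
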